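import Summits.QuantumFields.YangMills.Theorems.FluctuationComparisonRegPrIntLS2BetaInterBlock
import Literature.MathematicalPhysics.QuantumFieldTheory.Balaban1983to89.LatticeWordStokesLocal
import Literature.MathematicalPhysics.QuantumFieldTheory.Balaban1983to89.BlockAveragingPlaquetteBoundLocal
import Literature.MathematicalPhysics.QuantumFieldTheory.Balaban1983to89.BlockAveragingZd
import Literature.MathematicalPhysics.QuantumFieldTheory.Balaban1983to89.B3Taylor310LocalRemainder
import HarnessLib

/-!
# GAP♯∘'s KINEMATICS IN LOCAL FORM — the one-level relative comb-axial sup bounds with plaquette letters LOCAL to the block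
# (crux `FluctuationComparisonRegPrIntL`, stmt-QuantumFields-20520; registry v11.4 `Cruxes/FluctuationComparisonRegPrIntL/Lines/semiclassical_s2beta.lean` 3732b7df FROZEN, untouched)

Cell `ym3-torus` (YM ladder rung R3 = continuum `SU(2)` Yang–Mills on the three-torus — a RUNG: NOT d = 4, NOT infinite volume, NOT a mass gap, NOT Clay).
Width seat `ym3-torus-px12` (gen 22); `--kind proof --supports stmt-QuantumFields-20520 --as helper`, count-neutral, DEFINITION-FREE (0 `def`, 0 `instance`,
0 `notation`, 0 `sorry`, default heartbeats).

WHY.  The registered growth organs TUBE-REG∘ ∕ GAP♯∘ ask for a constant `μ` chosen BEFORE the run (`∃ μ, ∀ F γ J K V …`), i.e. uniform in the lattice VOLUME;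
every flat-datum growth letter in the tree (✓`…S2BetaFlatGapOutright.exists_tubeGrowth_flat`) has `μ` after `∀ K` (compactness).  A volume-uniform `ℓ²`
bound needs the kinematic sup machinery of [Balaban1985RegularSpaces] Lemma 1 (tree: ✓`Prop7AxialGaugeBlock.dist1_mul_inv_le_interior`,
✓`…S2BetaInterBlockCentral.dist1_central_link_le`, ✓`…S2BetaInterBlockFace` transfer, ✓`…S2BetaInterBlock` sweep — all stated with GLOBAL `PlaqSmall δ` letters)
with plaquette letters LOCAL to the block: a bond of `B(y)` must be controlled by the plaquettes near `B(y)` only, so that squaring and summing over the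
torus costs a multiplicity constant and no volume factor.  The local INPUTS are in Literature (✓`LatticeWordStokesLocal.dist1_holAt_le_local`,
✓`BlockAveragingPlaquetteBoundLocal.dist1_corr_le_local`); this file re-threads the four kinematic steps over them.

WHAT (one block level on the finest lattice of a torus `P`, pair `W, Y` with the SAME comb transporters from the centre of every `1`-block — the relative
comb-axial gauge of ✓`Prop7AxialGauge.exists_axialGauge (k := 1)`; locality in the `ℓ¹` torus distance `Site.tdist` to the block centre).
* §1 word ∕ block locality: `tdist (walkEnd x u) x ≤ |u|`, `tdist x y = |rel y x|₁`, the contour word's length, sites of the three blocks of a face.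
* §2 ★ `dist1_mul_inv_le_interior_local` — interior bonds (any gauge group, any `k`): `dist1(W_b·Y_b⁻¹) ≤ (ℓ²∕4 + ℓ²∕4)`-type bound with `ℓ = |ω_b|`, from the
  plaquettes of `W`, `Y` within `tdist ≤ 2·d·L^k` of the centre ONLY (∘ ✓`mul_inv_eq_conj_of_axial` + count-box Stokes).
* §3 ★ `dist1_central_link_le_local` — the central crossing link of a face (`SU(N)`, `ℰ = expMeanLogSU`): px8 g18's proof with ✓`dist1_corr_le_local`.
The companion file `…S2BetaOneStepLocalCrossingBounds` carries the face transfer, the sweep and the crossing links (px8 g18's parts B∕III in local form).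

HONEST: lattice kinematics ([Balaban1985RegularSpaces] Lemma 1 mechanism, local form; constants crude); nothing of Bałaban's analysis; TUBE-REG∘, GAP♯∘, EXW∘, S2β,
crux 20520 are NOT proved; no registered stub is closed; rung R3 = SU(2) YM₃ on T³ — NOT d = 4, NOT infinite volume, NOT a mass gap, NOT Clay; the Yang–Mills
mass gap is NOT proved.  Sorry-free, axioms standard.

References: T. Bałaban, CMP **99** (1985) 75–102 [Balaban1985RegularSpaces] ((1.19) p.79, Lemma 1 (1.24)–(1.26) pp.79–80); CMP **98** (1985) 17–51 [Balaban1985Averaging]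
((9) p.19, (19)–(20) p.21, pp.24–25); CMP **109** (1987) 249–301 [Balaban1987RG1] ((0.3)–(0.4) pp.252–253).
-/

set_option autoImplicit false

noncomputable section

namespace Summit.QuantumFields.YangMills.Theorems.FluctuationComparisonRegPrIntLS2BetaOneStepLocalAxialBounds

open Literature.MathematicalPhysics.QuantumFieldTheory.Balaban1983to89
open T4Continuum T4ReflectionCone BlockAveraging
open B7Prop1Explicit (e e_apply l1 l1_add_le treeWord length_treeWord disp_treeWord revWord length_revWord)
open B10Eq27TorusAxialLog (holT axialT rel rel_apply transl contourT contourT_eq holT_eq_holAt)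
open AveragingRT ExpMeanLog
open Summit.QuantumFields.YangMills.Theorems.FluctuationComparisonRegPrIntLS2BetaInterBlockCentral (axialAvg_eq_axialT_mul_mul_inv)
open Summit.QuantumFields.YangMills.Theorems.FluctuationComparisonRegPrIntLS2BetaInterBlockAlgebra
  (dist1_mul_inv_eq_of_conj_transport dist1_transport_ratio_le_of_corr)
open B10StarCount (unshift_shift)
open B5Eq118OneStroke (iterBlockOf)
open B15DeterminingSets (embIter)
open B3Taylor310LocalRemainder (tdist_eq_sum_natAbs tdist_comm tdist_self tdist_triangle tdist_unshift_le_one)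
open BlockAveragingZd (disp_eq_netDisp)
open LatticeWordStokesLocal (dist1_holAt_le_local)
open Summit.QuantumFields.YangMills.Theorems.Prop7AxialGaugeSup (revWord_eq_wordRev mul_inv_eq_conj_of_axial)
open Summit.QuantumFields.YangMills.Theorems.Prop7AxialGaugeBlock (l1_rel_centre_le noWrap_centre)

/-! ## §1 Word and block locality in the `ℓ¹` torus distance -/

section Locality

variable {P : Params} {j : ℕ}

/-- One lattice step moves a site by torus distance at most one (forward step; the tree's public twin is
`PoincareLipschitzLeungXinBallCaccioppoliTorus.tdist_shift_le_one`, not imported to keep the closure light). [folklore] -/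
private theorem tdist_shift_self_le (x : Site P j) (μ : Fin P.d) : Site.tdist (x.shift μ) x ≤ 1 := by
  have h := tdist_unshift_le_one (x.shift μ) μ
  rw [unshift_shift] at h
  rw [tdist_comm]; exact h

/-- **A walk of length `n` ends within torus distance `n` of its start.** [folklore] -/
theorem tdist_walkEnd_le : ∀ (x : Site P j) (u : List (Letter P.d)), Site.tdist (walkEnd x u) x ≤ u.length
  | x, [] => by rw [show walkEnd x [] = x from rfl, tdist_self]; exact le_rfl
  | x, (μ, true) :: u => by
    have ih := tdist_walkEnd_le (x.shift μ) u
    calc Site.tdist (walkEnd x ((μ, true) :: u)) x = Site.tdist (walkEnd (x.shift μ) u) x := rfl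
      _ ≤ Site.tdist (walkEnd (x.shift μ) u) (x.shift μ) + Site.tdist (x.shift μ) x := tdist_triangle _ _ _
      _ ≤ u.length + 1 := add_le_add ih (tdist_shift_self_le x μ)
      _ = ((μ, true) :: u).length := by simp
  | x, (μ, false) :: u => by
    have ih := tdist_walkEnd_le (x.unshift μ) u
    calc Site.tdist (walkEnd x ((μ, false) :: u)) x = Site.tdist (walkEnd (x.unshift μ) u) x := rfl
      _ ≤ Site.tdist (walkEnd (x.unshift μ) u) (x.unshift μ) + Site.tdist (x.unshift μ) x := tdist_triangle _ _ _
      _ ≤ u.length + 1 := add_le_add ih (tdist_unshift_le_one x μ)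
      _ = ((μ, false) :: u).length := by simp

/-- The torus distance IS the `ℓ¹` length of the relative position: `tdist x y = |rel y x|₁`. [folklore] -/
theorem tdist_eq_l1_rel (y x : Site P j) : Site.tdist x y = l1 (rel y x) := by
  rw [tdist_eq_sum_natAbs]; rfl

/-- A word using every letter at most as often as `w` is no longer than `w`. [folklore] -/
theorem length_le_of_count_le {d : ℕ} {u w : List (Letter d)} (h : ∀ l, u.count l ≤ w.count l) : u.length ≤ w.length :=
  (List.subperm_ext_iff.mpr fun a _ => h a).length_le

/-- The contour word `Γ_{y,x} ∪ [x, x+e_μ] ∪ (−Γ_{y,x+e_μ})` has length `≤ 2|x − y|₁ + 2`. [cite: Balaban1985UV3, (27) p.263] -/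
theorem length_contourT_le (y x : Site P j) (μ : Fin P.d) : (contourT y ⟨x, μ⟩).length ≤ 2 * l1 (rel y x) + 2 := by
  rw [contourT_eq]
  simp only [List.length_append, length_treeWord, List.length_singleton, length_revWord]
  have h := l1_add_le (rel y x) (e μ)
  have he : l1 (e μ : B7Prop1Explicit.Site P.d) ≤ 1 := by
    unfold l1
    rw [Finset.sum_eq_single μ (fun κ _ hκ => by simp [e_apply, hκ]) (fun h => (h (Finset.mem_univ _)).elim)]
    simp [e_apply]
  omega

/-- The contour word is closed: zero net displacement in every direction. [cite: Balaban1985UV3, (27) p.263] -/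
theorem netDisp_contourT (y x : Site P j) (μ ν : Fin P.d) : netDisp (contourT y ⟨x, μ⟩) ν = 0 := by
  have htree : ∀ (v : B7Prop1Explicit.Site P.d) (κ : Fin P.d), netDisp (treeWord v) κ = v κ := fun v κ => by
    rw [← disp_eq_netDisp, disp_treeWord]
  rw [contourT_eq, revWord_eq_wordRev, netDisp_append, netDisp_append, netDisp_wordRev, htree, htree, netDisp_cons]
  simp only [netDisp, List.map_nil, List.sum_nil, add_zero, Pi.add_apply, e_apply]
  by_cases h : ν = μ
  · subst h; simp
  · have h' : ¬ μ = ν := fun h'' => h h''.symm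
    simp [h, h']

/-- A site lies within torus distance `d·L^k` of the centre of its `k`-block (crude; `l1_rel_centre_le`). [cite: Balaban1987RG1, (0.1)-(0.3) p.252] -/
theorem tdist_centre_le {k : ℕ} (hk : k ≤ P.m + P.K) (z : Site P 0) : Site.tdist z (embIter k (iterBlockOf k z)) ≤ P.d * P.L ^ k := by
  rw [tdist_eq_l1_rel]
  exact (l1_rel_centre_le hk z).trans (Nat.mul_le_mul_left _ (Nat.sub_le _ _))

/-- Neighbouring block centres are at torus distance `≤ L`. [cite: Balaban1987RG1, (0.1) p.252] -/
theorem tdist_emb_shift_le (y : Site P (j + 1)) (μ : Fin P.d) : Site.tdist (emb (y.shift μ)) (emb y) ≤ P.L := by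
  rw [← walkEnd_replicate_L]
  exact (tdist_walkEnd_le _ _).trans (by simp)

/-- The same backwards: `tdist (emb (y − e_μ)) (emb y) ≤ L`. [cite: Balaban1987RG1, (0.1) p.252] -/
theorem tdist_emb_unshift_le (y : Site P (j + 1)) (μ : Fin P.d) : Site.tdist (emb (y.unshift μ)) (emb y) ≤ P.L := by
  have h := tdist_emb_shift_le (y.unshift μ) μ
  rw [B10StarCount.shift_unshift] at h
  rw [tdist_comm]; exact h

/-- Every site of the three blocks `B(y − e_μ)`, `B(y)`, `B(y + e_μ)` of a face lies within torus distance `d·L + L` of `emb y`. [cite: Balaban1987RG1, (0.3) p.252] -/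
theorem tdist_emb_le_of_three_blocks (hj : 1 ≤ P.m + P.K) (y : Site P 1) (μ : Fin P.d) (z : Site P 0)
    (hz : blockOf z = y.unshift μ ∨ blockOf z = y ∨ blockOf z = y.shift μ) : Site.tdist z (emb y) ≤ P.d * P.L + P.L := by
  have h1 : Site.tdist z (emb (blockOf z)) ≤ P.d * P.L := by
    have h := tdist_centre_le (k := 1) hj z
    rwa [pow_one] at h
  have h2 : Site.tdist (emb (blockOf z)) (emb y) ≤ P.L := by
    rcases hz with h | h | h
    · rw [h]; exact tdist_emb_unshift_le y μ
    · rw [h, tdist_self]; exact Nat.zero_le _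
    · rw [h]; exact tdist_emb_shift_le y μ
  exact (tdist_triangle _ _ _).trans (add_le_add h1 h2)

end Locality

/-! ## §2 Interior bonds: the relative comb-axial bound with LOCAL plaquette letters -/

section Interior

variable {P : Params} {j : ℕ} {G : Type*} [GaugeGroup G]

/-- **LOCAL STOKES FOR THE CONTOUR WORD**: if every plaquette based within torus distance `R ≥ |ω_b|` of `y` is within `a ≥ 0` of `1`, the holonomy of the
contour word `ω_b = Γ_{y,x} ∪ b ∪ (−Γ_{y,x+e_μ})` is within `(|ω_b|²∕4)·a` of `1` (∘ ✓`LatticeWordStokesLocal.dist1_holAt_le_local`: its count box lies in the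
ball, `tdist_walkEnd_le` + `length_le_of_count_le`). [cite: Balaban1985Averaging, (9) p.19 and (19)-(20) p.21] -/
theorem dist1_holT_contourT_le_local (V : GaugeField P j G) {a : ℝ} (ha : 0 ≤ a) (y x : Site P j) (μ : Fin P.d) {R : ℕ}
    (hR : (contourT y ⟨x, μ⟩).length ≤ R)
    (hV : ∀ q : Plaq P j, Site.tdist q.src y ≤ R → dist1 (GaugeField.plaqHol V q) < a) :
    dist1 (holT V y (contourT y ⟨x, μ⟩)) ≤ (((contourT y ⟨x, μ⟩).length : ℝ) ^ 2 / 4) * a := by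
  rw [holT_eq_holAt]
  exact dist1_holAt_le_local V ha y (contourT y ⟨x, μ⟩)
    (fun u hu a' b' hab => hV ⟨walkEnd y u, a', b', hab⟩ ((tdist_walkEnd_le y u).trans ((length_le_of_count_le hu).trans hR)))
    (netDisp_contourT y x μ)

/-- The contour word of a bond of the `k`-block of `x`, read from the block centre, has length `≤ 2·d·L^k`. [cite: Balaban1987RG1, (0.1)-(0.3) p.252] -/
theorem length_contourT_centre_le {k : ℕ} (hk : k ≤ P.m + P.K) (x : Site P 0) (μ : Fin P.d) :
    (contourT (embIter k (iterBlockOf k x)) ⟨x, μ⟩).length ≤ 2 * P.d * P.L ^ k := by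
  have h1 := length_contourT_le (embIter k (iterBlockOf k x)) x μ
  have h2 := l1_rel_centre_le hk x
  have hL : 1 ≤ P.L ^ k := Nat.one_le_pow _ _ P.L_pos
  have hd : 1 ≤ P.d := P.hd
  have h3 : P.d * (P.L ^ k - 1) + P.d = P.d * P.L ^ k := by
    rw [Nat.mul_sub_one, Nat.sub_add_cancel (Nat.le_mul_of_pos_right _ hL)]
  nlinarith

/-- ★ **INTERIOR BONDS, LOCAL LETTERS** (any gauge group, any torus, `k ≤ m + K`): `W`, `Y` with the same comb transporters from the centre of every `k`-block, a
bond `⟨x, μ⟩` with both endpoints in one `k`-block, and the plaquettes of `W` (resp. `Y`) based within torus distance `2·d·L^k` of the centre of that block within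
`a_W` (resp. `a_Y`) of `1` ⟹ `dist1(W_b·Y_b⁻¹) ≤ (d·L^k)²·(a_W + a_Y)` — the local edition of ✓`Prop7AxialGaugeBlock.dist1_mul_inv_le_interior`.
[cite: Balaban1985RegularSpaces, Lemma 1 (1.25) p.79; Balaban1985Averaging, pp.24-25] -/
theorem dist1_mul_inv_le_interior_local {k : ℕ} (hk : k ≤ P.m + P.K) (W Y : GaugeField P 0 G) {aW aY : ℝ} (haW : 0 ≤ aW) (haY : 0 ≤ aY)
    (hax : ∀ x : Site P 0, axialT W (embIter k (iterBlockOf k x)) x = axialT Y (embIter k (iterBlockOf k x)) x)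
    (x : Site P 0) (μ : Fin P.d) (hblock : iterBlockOf k (x.shift μ) = iterBlockOf k x)
    (hW : ∀ q : Plaq P 0, Site.tdist q.src (embIter k (iterBlockOf k x)) ≤ 2 * P.d * P.L ^ k → dist1 (GaugeField.plaqHol W q) < aW)
    (hY : ∀ q : Plaq P 0, Site.tdist q.src (embIter k (iterBlockOf k x)) ≤ 2 * P.d * P.L ^ k → dist1 (GaugeField.plaqHol Y q) < aY) :
    dist1 (W ⟨x, μ⟩ * (Y ⟨x, μ⟩)⁻¹) ≤ ((P.d : ℝ) * (P.L : ℝ) ^ k) ^ 2 * (aW + aY) := by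
  set y := embIter k (iterBlockOf k x) with hy
  have hax' : axialT W y (x.shift μ) = axialT Y y (x.shift μ) := by
    have h := hax (x.shift μ)
    rwa [hblock] at h
  rw [mul_inv_eq_conj_of_axial W Y y x μ (noWrap_centre hk x μ) (hax x) hax']
  have hconj : dist1 ((axialT Y y x)⁻¹ * (holT W y (contourT y ⟨x, μ⟩) * (holT Y y (contourT y ⟨x, μ⟩))⁻¹) * axialT Y y x) =
      dist1 (holT W y (contourT y ⟨x, μ⟩) * (holT Y y (contourT y ⟨x, μ⟩))⁻¹) := by
    have h := GaugeGroup.dist1_conj (holT W y (contourT y ⟨x, μ⟩) * (holT Y y (contourT y ⟨x, μ⟩))⁻¹) (axialT Y y x)⁻¹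
    rwa [inv_inv] at h
  rw [hconj]
  have hlen := length_contourT_centre_le hk x μ
  have hWl := dist1_holT_contourT_le_local W haW y x μ hlen hW
  have hYl := dist1_holT_contourT_le_local Y haY y x μ hlen hY
  have hℓ : ((contourT y ⟨x, μ⟩).length : ℝ) ≤ 2 * ((P.d : ℝ) * (P.L : ℝ) ^ k) := by
    have h : ((contourT y ⟨x, μ⟩).length : ℝ) ≤ ((2 * P.d * P.L ^ k : ℕ) : ℝ) := by exact_mod_cast hlen
    simpa [mul_assoc] using h
  have hℓ0 : (0 : ℝ) ≤ ((contourT y ⟨x, μ⟩).length : ℝ) := Nat.cast_nonneg _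
  have hsq : ((contourT y ⟨x, μ⟩).length : ℝ) ^ 2 / 4 ≤ ((P.d : ℝ) * (P.L : ℝ) ^ k) ^ 2 := by
    have h := pow_le_pow_left₀ hℓ0 hℓ 2
    nlinarith
  calc dist1 (holT W y (contourT y ⟨x, μ⟩) * (holT Y y (contourT y ⟨x, μ⟩))⁻¹)
      ≤ dist1 (holT W y (contourT y ⟨x, μ⟩)) + dist1 ((holT Y y (contourT y ⟨x, μ⟩))⁻¹) := GaugeGroup.dist1_mul_le _ _
    _ = dist1 (holT W y (contourT y ⟨x, μ⟩)) + dist1 (holT Y y (contourT y ⟨x, μ⟩)) := by rw [GaugeGroup.dist1_inv]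
    _ ≤ (((contourT y ⟨x, μ⟩).length : ℝ) ^ 2 / 4) * aW + (((contourT y ⟨x, μ⟩).length : ℝ) ^ 2 / 4) * aY := add_le_add hWl hYl
    _ ≤ ((P.d : ℝ) * (P.L : ℝ) ^ k) ^ 2 * aW + ((P.d : ℝ) * (P.L : ℝ) ^ k) ^ 2 * aY :=
        add_le_add (mul_le_mul_of_nonneg_right hsq haW) (mul_le_mul_of_nonneg_right hsq haY)
    _ = ((P.d : ℝ) * (P.L : ℝ) ^ k) ^ 2 * (aW + aY) := by ring

end Interior

/-! ## §3 The central crossing link of a face, LOCAL letters -/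

section Central

open scoped Matrix.Norms.L2Operator

variable {P : Params} {j : ℕ} {n : Type*} [Fintype n] [DecidableEq n] [Nonempty n]

/-- ★ **THE CENTRAL CROSSING LINK IS WITHIN `α₁ + 2ρ`, LOCAL LETTERS** — px8 g18's ✓`…InterBlockCentral.dist1_central_link_le` with the plaquette letter asked ONLY of
the plaquettes based in the three blocks `B(y − e_μ) ∪ B(y) ∪ B(y + e_μ)` (✓`BlockAveragingPlaquetteBoundLocal.dist1_corr_le_local` in place of the global corr bound):
two `SU(N)` configurations `W, Y` with those plaquettes within `a ≥ 0` of `1` (`(((d+2)L)²∕4)·a < δ_N`), the SAME comb transporters from `emb y` to the axis point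
`x₀` and from `emb (y+e_μ)` to `x₀ + e_μ`, and (0.4)-averages at `c = ⟨y, μ⟩` within `α₁` ⟹ `dist1(W(ℓ₀)·Y(ℓ₀)⁻¹) ≤ α₁ + 2·6·(((d+2)L)²∕4)·a`.
[cite: Balaban1985RegularSpaces, Lemma 1 (1.25) p.79; Balaban1987RG1, (0.4) p.253; Balaban1985Averaging, (19)-(20) p.21] -/
theorem dist1_central_link_le_local (hj : j + 1 ≤ P.m + P.K) {a α₁ : ℝ} (ha : 0 ≤ a)
    (W Y : GaugeField P j (Matrix.specialUnitaryGroup n ℂ)) (y : Site P (j + 1)) (μ : Fin P.d)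
    (hW : ∀ q : Plaq P j, (blockOf q.src = y.unshift μ ∨ blockOf q.src = y ∨ blockOf q.src = y.shift μ) →
      dist1 (GaugeField.plaqHol W q) < a)
    (hY : ∀ q : Plaq P j, (blockOf q.src = y.unshift μ ∨ blockOf q.src = y ∨ blockOf q.src = y.shift μ) →
      dist1 (GaugeField.plaqHol Y q) < a)
    (ht : ((((P.d + 2) * P.L : ℕ) : ℝ) ^ 2 / 4) * a < deltaSU n)
    (hax₀ : axialT W (emb y) (transl (emb y) ((((P.L - 1) / 2 : ℕ) : ℤ) • e μ)) =
      axialT Y (emb y) (transl (emb y) ((((P.L - 1) / 2 : ℕ) : ℤ) • e μ)))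
    (hax₁ : axialT W (emb (y.shift μ)) ((transl (emb y) ((((P.L - 1) / 2 : ℕ) : ℤ) • e μ)).shift μ) =
      axialT Y (emb (y.shift μ)) ((transl (emb y) ((((P.L - 1) / 2 : ℕ) : ℤ) • e μ)).shift μ))
    (havg : dist1 (avgFun (expMeanLogSU (n := n)) W ⟨y, μ⟩ * (avgFun (expMeanLogSU (n := n)) Y ⟨y, μ⟩)⁻¹) ≤ α₁) :
    dist1 (W ⟨transl (emb y) ((((P.L - 1) / 2 : ℕ) : ℤ) • e μ), μ⟩ *
        (Y ⟨transl (emb y) ((((P.L - 1) / 2 : ℕ) : ℤ) • e μ), μ⟩)⁻¹) ≤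
      α₁ + 2 * (6 * (((((P.d + 2) * P.L : ℕ) : ℝ) ^ 2 / 4) * a)) := by
  unfold avgFun at havg
  rw [axialAvg_eq_axialT_mul_mul_inv hj W, axialAvg_eq_axialT_mul_mul_inv hj Y, hax₀, hax₁] at havg
  rw [dist1_mul_inv_eq_of_conj_transport (axialT Y (emb y) (transl (emb y) ((((P.L - 1) / 2 : ℕ) : ℤ) • e μ))) _
    (axialT Y (emb (y.shift μ)) ((transl (emb y) ((((P.L - 1) / 2 : ℕ) : ℤ) • e μ)).shift μ))⁻¹]
  exact dist1_transport_ratio_le_of_corr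
    (BlockAveragingPlaquetteBoundLocal.dist1_corr_le_local ha hj ⟨y, μ⟩ hW ht)
    (BlockAveragingPlaquetteBoundLocal.dist1_corr_le_local ha hj ⟨y, μ⟩ hY ht) havg

end Central

end Summit.QuantumFields.YangMills.Theorems.FluctuationComparisonRegPrIntLS2BetaOneStepLocalAxialBounds

end
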